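/-
Copyright (c) 2026 the pub-hodgecm-mathlib formalisation cell (harness21).  Prover seat hodgecm-mathlib-K2Liu-p11 (g2), Track B «K2-LIT»,
#184♮ = hLiu418 = `stmt-HodgeConjecture-24832`; LEAD F0P6-plan (g13) 10:13:40Z «the 20-line corollary `n_{τ′}(½) = 0` by the second
lander» ∕ LEAD F0P6-plan (g14) BATCH #1 (γ) «(CR-loc) corollary» ∕ K2Liu-p11 (g2) (C2′): the `𝔭⁺` ∕ `k = −1` MIRROR of ★ (C2).  THEOREMS ONLY (no `def`, no `instance`, no notation,
no named-fact hypothesis, no `sorry`).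
-/
import Summits.HodgeConjecture.HodgeConjecture.Theorems.K2LiuArchIntertwiningLieDerivativeExp  -- ★ K2E5-p16 (g6) (A): swap + closed form (`exp` form)
import Summits.HodgeConjecture.HodgeConjecture.Theorems.K2LiuArchScalarSectionPDerivative      -- ★ (this seat) (B) FILE 2: `pMinus_algebra`, letters
import Summits.HodgeConjecture.HodgeConjecture.Theorems.K2LiuArchPMinusCarrier                  -- ★ (this seat) (C1): the carriers are flat
import Summits.HodgeConjecture.HodgeConjecture.Theorems.K2LiuArchPMinusIntertwiningKernel      -- ★ (this seat) (C2): `archIntertwining_congr_UJ`, `integrable_lieDeriv_exp`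
import Summits.HodgeConjecture.HodgeConjecture.Theorems.K2LiuArchNormalisedScalarCont          -- ★ (this lineage): `n_k`, `M*`
import Summits.HodgeConjecture.HodgeConjecture.Theorems.K2LiuHermitianTubeCRDeriv               -- ★ (this lineage): `μ b ∈ 𝔲(J)`
import Summits.HodgeConjecture.HodgeConjecture.Theorems.K2LiuHermitianTubeCRCartan              -- ★ (this lineage): `σ b ∈ 𝔲(J)`
import Mathlib.Analysis.Complex.CauchyIntegral
import Mathlib.Analysis.Analytic.Uniqueness
import HarnessLib

/-!
# Crux `HLiu418`, A∞ organ: the `𝔭⁺` (CR-loc) recursion and the `𝔭⁺`-KERNEL OF `M*_w(½)` on the mirror line type `k = −1`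

Cell `hodgecm-mathlib`, crux item hLiu418 = `stmt-HodgeConjecture-24832` (helper lane `--supports`, count-neutral).

MIRROR of ★ (C2) `K2LiuArchPMinusIntertwiningKernel` (read there for the mechanism): with `𝔭⁺(b)• = D_{μb} + i·D_{σb}` and ★ (B)
`pPlus_algebra` (`D_{μb} f⁰_{s,k} + i·D_{σb} f⁰_{s,k} = λ⁺_k(s)·φ⁺_{b,s}`, `λ⁺_k(s) = 2s + 2 + k`, `φ⁺_{b,s} = f⁰_{s,k}·T_b`):
* §1 the two flat-family letters of `φ⁺` not recorded in ★ (C1) (`pPlusCarrier_stab_eq`, `eq_pPlusCarrier_of_flat`);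
* §2 **`(2s + 2 + k) · M_w φ⁺_{b,s} = c_k(s) · (2 − 2s + k) · φ⁺_{b,−s}`** on `U(2,2)`, `re s > ½` (★ (A) at `W = μ b, σ b`), and its normalised form;
* §3 the mirror Gaussian line type `k = −1`: **`M*_w(s) φ⁺_{b,s} = ((1 − 2s)∕(1 + 2s)) · φ⁺_{b,−s}`** (`n_{−1} ≡ 1`);
* §4 **`pPlus_half_eq_zero`** — every holomorphic continuation of `s ↦ M*_w(s)(F s)(h)`, `F` the flat family through `φ⁺_{b,½}` (weight `−1`),
  vanishes at `s = ½`: the arch clause of U1-glob(σ) at the type `τ″ = k₀ ⊗ 𝔭⁺`, `k₀ = −1` (the (CR) face for the sign `ε` with `𝔭^{+}`-killing).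
References: [Shimura1997, §16.4]; [Knapp1986, Ch. VII §2]; [KudlaRallis1994 (citation only)].
HONEST LABEL: HC_CM is proved only modulo the 7 printed citations (2 remaining named inputs: hLiu418 = stmt-HodgeConjecture-24832,
h413 = stmt-HodgeConjecture-24833) until rung 0 closes; count-neutral helper, closes no socket.
-/

set_option autoImplicit false
set_option linter.dupNamespace false

noncomputable section

open Complex Matrix Filter MeasureTheory Set
open scoped ComplexConjugate ComplexOrder Topology

namespace Summit.HodgeConjecture.HodgeConjecture.Cruxes.HLiu418.K2LiuArchPPlusIntertwiningKernel

open Literature.NumberTheory.ModularForms.SiegelUpperHalfSpace (denom moeb)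
open Summit.HodgeConjecture.HodgeConjecture.Cruxes.HLiu418.K2LiuHermitianTubeCocycle
open Summit.HodgeConjecture.HodgeConjecture.Cruxes.HLiu418.K2LiuArchInducedTubeDefs
open Summit.HodgeConjecture.HodgeConjecture.Cruxes.HLiu418.K2LiuArchNormalisingScalar
open Summit.HodgeConjecture.HodgeConjecture.Cruxes.HLiu418.K2LiuArchNormalisedScalarCont
open Summit.HodgeConjecture.HodgeConjecture.Cruxes.HLiu418.K2LiuArchIntertwiningRightEquivariance
open Summit.HodgeConjecture.HodgeConjecture.Cruxes.HLiu418.K2LiuArchScalarSectionCurveDerivative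
open Summit.HodgeConjecture.HodgeConjecture.Cruxes.HLiu418.K2LiuArchScalarSectionPDerivative
open Summit.HodgeConjecture.HodgeConjecture.Cruxes.HLiu418.K2LiuArchPMinusCarrier
open Summit.HodgeConjecture.HodgeConjecture.Cruxes.HLiu418.K2LiuArchIntertwiningContinuedHalf
open Summit.HodgeConjecture.HodgeConjecture.Cruxes.HLiu418.K2LiuArchIntertwiningLieDerivative
open Summit.HodgeConjecture.HodgeConjecture.Cruxes.HLiu418.K2LiuArchIntertwiningLieDerivativeExp
open Summit.HodgeConjecture.HodgeConjecture.Cruxes.HLiu418.K2LiuLieRayDifferentiability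
open Summit.HodgeConjecture.HodgeConjecture.Cruxes.HLiu418.K2LiuHermitianTubeCRDeriv
open Summit.HodgeConjecture.HodgeConjecture.Cruxes.HLiu418.K2LiuArchPMinusIntertwiningKernel
open Summit.HodgeConjecture.HodgeConjecture.Cruxes.HLiu418.K2LiuArchInducedTubeSectionPrelims

/-! ## §1  The two flat-family letters of `φ⁺` -/

/-- Two values of `φ⁺` at different parameters agree on the stabiliser: `φ⁺_{b,s}(u) = φ⁺_{b,s′}(u)`. [Shimura1997, §16.4] -/
theorem pPlusCarrier_stab_eq {l : Type*} [Fintype l] [DecidableEq l] (k : ℤ) (s s' : ℂ) (b : Matrix l l ℂ) {u : Matrix (l ⊕ l) (l ⊕ l) ℂ}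
    (hu : uᴴ * Matrix.J l ℂ * u = Matrix.J l ℂ) (huI : moeb u (I • (1 : Matrix l l ℂ)) = I • 1) :
    archScalarSection k s u * ((denom u (I • (1 : Matrix l l ℂ)))⁻¹ * denom u (-(I • (1 : Matrix l l ℂ))) * b).trace =
      archScalarSection k s' u * ((denom u (I • (1 : Matrix l l ℂ)))⁻¹ * denom u (-(I • (1 : Matrix l l ℂ))) * b).trace := by
  rw [archScalarSection_stab k s hu huI, archScalarSection_stab k s' hu huI]

/-- **THE FLAT FAMILY THROUGH `φ⁺_{b,s₀}` IS `s ↦ φ⁺_{b,s}`**: any family with the weight-`k` Siegel-parabolic law whose restriction to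
`U(J) ∩ Stab(i1)` is that of `φ⁺_{b,s₀}` equals `φ⁺_{b,s}` on `U(J)` (★ (C1) §0 + `isArchSiegelSection_pPlusCarrier`). [Shimura1997, §16.4] -/
theorem eq_pPlusCarrier_of_flat {l : Type*} [Fintype l] [DecidableEq l] (k : ℤ) (s s₀ : ℂ) (b : Matrix l l ℂ)
    {F : Matrix (l ⊕ l) (l ⊕ l) ℂ → ℂ} (hF : IsArchSiegelSection (fun z : ℂ => (conj z / ((‖z‖ : ℝ) : ℂ)) ^ k) s F)
    (hK : ∀ u : Matrix (l ⊕ l) (l ⊕ l) ℂ, uᴴ * Matrix.J l ℂ * u = Matrix.J l ℂ → moeb u (I • (1 : Matrix l l ℂ)) = I • 1 →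
      F u = archScalarSection k s₀ u * ((denom u (I • (1 : Matrix l l ℂ)))⁻¹ * denom u (-(I • (1 : Matrix l l ℂ))) * b).trace)
    {g : Matrix (l ⊕ l) (l ⊕ l) ℂ} (hg : gᴴ * Matrix.J l ℂ * g = Matrix.J l ℂ) :
    F g = archScalarSection k s g * ((denom g (I • (1 : Matrix l l ℂ)))⁻¹ * denom g (-(I • (1 : Matrix l l ℂ))) * b).trace :=
  eq_of_isArchSiegelSection_of_eqOn_stab hF (isArchSiegelSection_pPlusCarrier k s b)
    (fun u hu huI => by rw [hK u hu huI, pPlusCarrier_stab_eq k s₀ s b hu huI]) hg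

/-! ## §2  The `𝔭⁺` recursion `λ⁺_k(s) · M_w φ⁺_{b,s} = c_k(s) · λ⁺_k(−s) · φ⁺_{b,−s}` -/

/-- **THE `𝔭⁺` (CR-loc) RECURSION** for hermitian `b`, `g ∈ U(2,2)`, `re s > ½`:
`(2s + 2 + k) · M_w φ⁺_{b,s} (g) = c_k(s) · (2 − 2s + k) · φ⁺_{b,−s}(g)`, `φ⁺_{b,s} = f⁰_{s,k} · T_b` — from ★ (A) at `W = μ b, σ b` and
★ (B) `pPlus_algebra` ∕ `trace_letters_mu_sigma`; NO multiplicity-one input. [Shimura1997, §16.4; Knapp1986, Ch. VII §2] -/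
theorem lambdaPlus_mul_archIntertwining_pPlusCarrier (k : ℤ) {s : ℂ} (hs : 1 / 2 < s.re)
    {g : Matrix (Fin 2 ⊕ Fin 2) (Fin 2 ⊕ Fin 2) ℂ} (hg : gᴴ * Matrix.J (Fin 2) ℂ * g = Matrix.J (Fin 2) ℂ)
    {b : Matrix (Fin 2) (Fin 2) ℂ} (hb : bᴴ = b) :
    (2 * s + 2 + k) * archIntertwining (fun y => archScalarSection k s y *
        ((denom y (I • (1 : Matrix (Fin 2) (Fin 2) ℂ)))⁻¹ * denom y (-(I • (1 : Matrix (Fin 2) (Fin 2) ℂ))) * b).trace) g =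
      archScalarCoeff k s * ((2 * (-s) + 2 + k) * (archScalarSection k (-s) g *
        ((denom g (I • (1 : Matrix (Fin 2) (Fin 2) ℂ)))⁻¹ * denom g (-(I • (1 : Matrix (Fin 2) (Fin 2) ℂ))) * b).trace)) := by
  -- the two real letters
  have hμ := levi_gen_mem (l := Fin 2) hb
  have hσ := K2LiuHermitianTubeCRCartan.sigma_gen_mem (l := Fin 2) hb
  -- ★ (A): the closed forms for `W = μ b` and `W = σ b`
  have hAμ := archIntertwining_lieDeriv_archScalarSection_exp_eq k hs hg (conjTranspose_exp_mul_J_mul_exp hμ)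
  have hAσ := archIntertwining_lieDeriv_archScalarSection_exp_eq k hs hg (conjTranspose_exp_mul_J_mul_exp hσ)
  -- integrability of the two Lie-derivative integrands (to split `M_w` over the difference)
  have hIμ := integrable_lieDeriv_exp k hs hg (fromBlocks b 0 0 (-b))
  have hIσ := integrable_lieDeriv_exp k hs hg (fromBlocks 0 b b 0)
  -- abbreviations for the two `D_W f⁰_{s,k}` integrands as functions on `M₄(ℂ)`
  set m : ℂ := (k : ℂ) - 2 * s - 2 with hm
  set m' : ℂ := (k : ℂ) - 2 * (-s) - 2 with hm'
  set Dμ : Matrix (Fin 2 ⊕ Fin 2) (Fin 2 ⊕ Fin 2) ℂ → ℂ := fun y => archScalarSection k s y *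
      ((m / 2 - k) * ((denom y (I • (1 : Matrix (Fin 2) (Fin 2) ℂ)))⁻¹ *
          denom (y * fromBlocks b 0 0 (-b)) (I • (1 : Matrix (Fin 2) (Fin 2) ℂ))).trace +
        m / 2 * conj ((denom y (I • (1 : Matrix (Fin 2) (Fin 2) ℂ)))⁻¹ *
          denom (y * fromBlocks b 0 0 (-b)) (I • (1 : Matrix (Fin 2) (Fin 2) ℂ))).trace) with hDμ
  set Dσ : Matrix (Fin 2 ⊕ Fin 2) (Fin 2 ⊕ Fin 2) ℂ → ℂ := fun y => archScalarSection k s y *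
      ((m / 2 - k) * ((denom y (I • (1 : Matrix (Fin 2) (Fin 2) ℂ)))⁻¹ *
          denom (y * fromBlocks 0 b b 0) (I • (1 : Matrix (Fin 2) (Fin 2) ℂ))).trace +
        m / 2 * conj ((denom y (I • (1 : Matrix (Fin 2) (Fin 2) ℂ)))⁻¹ *
          denom (y * fromBlocks 0 b b 0) (I • (1 : Matrix (Fin 2) (Fin 2) ℂ))).trace) with hDσ
  -- pointwise: `Dμ y + i·Dσ y = (2s + 2 + k)·φ⁺_{b,s}(y)` (★ (B), generic `y`)
  have hcomb : ∀ (t : ℂ) (y : Matrix (Fin 2 ⊕ Fin 2) (Fin 2 ⊕ Fin 2) ℂ),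
      archScalarSection k t y * ((((k : ℂ) - 2 * t - 2) / 2 - k) *
            ((denom y (I • (1 : Matrix (Fin 2) (Fin 2) ℂ)))⁻¹ * denom (y * fromBlocks b 0 0 (-b)) (I • (1 : Matrix (Fin 2) (Fin 2) ℂ))).trace +
          ((k : ℂ) - 2 * t - 2) / 2 *
            conj ((denom y (I • (1 : Matrix (Fin 2) (Fin 2) ℂ)))⁻¹ * denom (y * fromBlocks b 0 0 (-b)) (I • (1 : Matrix (Fin 2) (Fin 2) ℂ))).trace) +
        I * (archScalarSection k t y * ((((k : ℂ) - 2 * t - 2) / 2 - k) *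
            ((denom y (I • (1 : Matrix (Fin 2) (Fin 2) ℂ)))⁻¹ * denom (y * fromBlocks 0 b b 0) (I • (1 : Matrix (Fin 2) (Fin 2) ℂ))).trace +
          ((k : ℂ) - 2 * t - 2) / 2 *
            conj ((denom y (I • (1 : Matrix (Fin 2) (Fin 2) ℂ)))⁻¹ * denom (y * fromBlocks 0 b b 0) (I • (1 : Matrix (Fin 2) (Fin 2) ℂ))).trace)) =
        (2 * t + 2 + k) * (archScalarSection k t y *
          ((denom y (I • (1 : Matrix (Fin 2) (Fin 2) ℂ)))⁻¹ * denom y (-(I • (1 : Matrix (Fin 2) (Fin 2) ℂ))) * b).trace) := by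
    intro t y
    obtain ⟨h1, h2⟩ := trace_letters_mu_sigma (l := Fin 2) y b
    rw [pPlus_algebra _ _ _ _ _ _ h1 h2]
    ring
  -- left side: `M_w (Dμ + i·Dσ) = M_w ((2s+2+k) φ⁺_{b,s})`
  have hL : archIntertwining Dμ g + I * archIntertwining Dσ g =
      (2 * s + 2 + k) * archIntertwining (fun y => archScalarSection k s y *
        ((denom y (I • (1 : Matrix (Fin 2) (Fin 2) ℂ)))⁻¹ * denom y (-(I • (1 : Matrix (Fin 2) (Fin 2) ℂ))) * b).trace) g := by
    rw [← archIntertwining_const_mul I Dσ g, ← archIntertwining_add hIμ (hIσ.const_mul I |>.congr ?_), ← archIntertwining_const_mul]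
    · congr 1
      funext y
      exact hcomb s y
    · exact Filter.Eventually.of_forall fun r => rfl
  -- right side: the closed forms, combined by the same algebra at `−s`
  have hR : archIntertwining Dμ g + I * archIntertwining Dσ g =
      archScalarCoeff k s * ((2 * (-s) + 2 + k) * (archScalarSection k (-s) g *
        ((denom g (I • (1 : Matrix (Fin 2) (Fin 2) ℂ)))⁻¹ * denom g (-(I • (1 : Matrix (Fin 2) (Fin 2) ℂ))) * b).trace)) := by
    rw [hDμ, hDσ, hAμ, hAσ, ← hcomb (-s) g]
    ring
  rw [← hL, hR]

/-- **THE NORMALISED `𝔭⁺` RECURSION, BY THE CONTINUED NAME**: for hermitian `b`, `g ∈ U(2,2)`, `re s > ½`,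
`(2s + 2 + k) · M*_w(s) φ⁺_{b,s} (g) = n_k(s) · (2 − 2s + k) · φ⁺_{b,−s}(g)`. [Shimura1997, §16.4; KudlaRallis1994 (citation only)] -/
theorem lambdaPlus_mul_archIntertwiningNormalized_pPlusCarrier (k : ℤ) {s : ℂ} (hs : 1 / 2 < s.re)
    {g : Matrix (Fin 2 ⊕ Fin 2) (Fin 2 ⊕ Fin 2) ℂ} (hg : gᴴ * Matrix.J (Fin 2) ℂ * g = Matrix.J (Fin 2) ℂ)
    {b : Matrix (Fin 2) (Fin 2) ℂ} (hb : bᴴ = b) :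
    (2 * s + 2 + k) * archIntertwiningNormalized s (fun y => archScalarSection k s y *
        ((denom y (I • (1 : Matrix (Fin 2) (Fin 2) ℂ)))⁻¹ * denom y (-(I • (1 : Matrix (Fin 2) (Fin 2) ℂ))) * b).trace) g =
      archNormalisedScalarCont k s * ((2 - 2 * s + k) * (archScalarSection k (-s) g *
        ((denom g (I • (1 : Matrix (Fin 2) (Fin 2) ℂ)))⁻¹ * denom g (-(I • (1 : Matrix (Fin 2) (Fin 2) ℂ))) * b).trace)) := by
  rw [archIntertwiningNormalized_apply, archNormalisedScalarCont_eq k hs, mul_left_comm, lambdaPlus_mul_archIntertwining_pPlusCarrier k hs hg hb]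
  ring

/-! ## §3  The mirror Gaussian line type `k = −1`: `M*_w(s) φ⁺_{b,s} = ((1 − 2s)∕(1 + 2s)) · φ⁺_{b,−s}` -/

/-- **THE MIRROR LINE TYPE**: for `k = −1`, hermitian `b`, `g ∈ U(2,2)`, `re s > ½`:
`M*_w(s) φ⁺_{b,s} (g) = ((1 − 2s)∕(1 + 2s)) · φ⁺_{b,−s}(g)` (`n_{−1} ≡ 1`, ★ `archNormalisedScalarCont_of_natAbs_eq_one`).
[Shimura1997, §16.4; KudlaRallis1994 (citation only)] -/
theorem archIntertwiningNormalized_pPlusCarrier_neg_one {s : ℂ} (hs : 1 / 2 < s.re)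
    {g : Matrix (Fin 2 ⊕ Fin 2) (Fin 2 ⊕ Fin 2) ℂ} (hg : gᴴ * Matrix.J (Fin 2) ℂ * g = Matrix.J (Fin 2) ℂ)
    {b : Matrix (Fin 2) (Fin 2) ℂ} (hb : bᴴ = b) :
    archIntertwiningNormalized s (fun y => archScalarSection (-1) s y *
        ((denom y (I • (1 : Matrix (Fin 2) (Fin 2) ℂ)))⁻¹ * denom y (-(I • (1 : Matrix (Fin 2) (Fin 2) ℂ))) * b).trace) g =
      (1 - 2 * s) / (1 + 2 * s) * (archScalarSection (-1) (-s) g *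
        ((denom g (I • (1 : Matrix (Fin 2) (Fin 2) ℂ)))⁻¹ * denom g (-(I • (1 : Matrix (Fin 2) (Fin 2) ℂ))) * b).trace) := by
  have h := lambdaPlus_mul_archIntertwiningNormalized_pPlusCarrier (-1) hs hg hb
  rw [archNormalisedScalarCont_of_natAbs_eq_one (by norm_num) s, one_mul, Int.cast_neg, Int.cast_one] at h
  have hne : (2 * s + 2 + -1 : ℂ) ≠ 0 := by
    rw [show (2 * s + 2 + -1 : ℂ) = 1 + 2 * s by ring]
    exact one_add_two_mul_ne_zero (by linarith)
  have h' := congrArg (fun z => (2 * s + 2 + -1 : ℂ)⁻¹ * z) h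
  rw [← mul_assoc, inv_mul_cancel₀ hne, one_mul] at h'
  rw [h', show (2 - 2 * s + -1 : ℂ) = 1 - 2 * s by ring, show (2 * s + 2 + -1 : ℂ) = 1 + 2 * s by ring]
  field_simp

/-! ## §4  The face at `s = ½`: the continued `M*_w` KILLS the `𝔭⁺`-type through the mirror Gaussian line -/

/-- **`𝔭⁺`-KERNEL OF THE CONTINUED NORMALISED OPERATOR AT `s = ½` (mirror line type `k = −1`).**  Let `b` be hermitian, `h ∈ U(2,2)`,
and let `F s` be, for `½ < re s`, ANY family with the weight-`(−1)` Siegel-parabolic law whose restriction to `U(J) ∩ Stab(i1)` is that of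
the `𝔭⁺`-carrier `φ⁺_{b,½}` (the flat family through `𝔭⁺(b)•f⁰_{½,−1} = 2·φ⁺_{b,½}` up to the factor `2`; §1 `eq_pPlusCarrier_of_flat`).
Then every `Fn` holomorphic on `{0 < re s}` with `Fn s = M*_w(s) (F s) (h)` on `½ < re s` satisfies **`Fn (½) = 0`** — the arch clause of
U1-glob(σ) at the `K_w`-type `τ″ = k₀ ⊗ 𝔭⁺`, `k₀ = −1`. [Shimura1997, §16.4; KudlaRallis1994 (citation only)] -/
theorem pPlus_half_eq_zero {b : Matrix (Fin 2) (Fin 2) ℂ} (hb : bᴴ = b)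
    {h : Matrix (Fin 2 ⊕ Fin 2) (Fin 2 ⊕ Fin 2) ℂ} (hh : hᴴ * Matrix.J (Fin 2) ℂ * h = Matrix.J (Fin 2) ℂ)
    {F : ℂ → Matrix (Fin 2 ⊕ Fin 2) (Fin 2 ⊕ Fin 2) ℂ → ℂ}
    (hP : ∀ s : ℂ, 1 / 2 < s.re → IsArchSiegelSection (fun z : ℂ => (conj z / ((‖z‖ : ℝ) : ℂ)) ^ (-1 : ℤ)) s (F s))
    (hK : ∀ s : ℂ, 1 / 2 < s.re → ∀ u : Matrix (Fin 2 ⊕ Fin 2) (Fin 2 ⊕ Fin 2) ℂ, uᴴ * Matrix.J (Fin 2) ℂ * u = Matrix.J (Fin 2) ℂ →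
      moeb u (I • (1 : Matrix (Fin 2) (Fin 2) ℂ)) = I • 1 →
        F s u = archScalarSection (-1) (1 / 2) u *
          ((denom u (I • (1 : Matrix (Fin 2) (Fin 2) ℂ)))⁻¹ * denom u (-(I • (1 : Matrix (Fin 2) (Fin 2) ℂ))) * b).trace)
    {Fn : ℂ → ℂ} (hFn : DifferentiableOn ℂ Fn {s : ℂ | 0 < s.re})
    (hagree : ∀ s : ℂ, 1 / 2 < s.re → Fn s = archIntertwiningNormalized s (F s) h) :
    Fn (1 / 2) = 0 := by
  set T : ℂ := ((denom h (I • (1 : Matrix (Fin 2) (Fin 2) ℂ)))⁻¹ * denom h (-(I • (1 : Matrix (Fin 2) (Fin 2) ℂ))) * b).trace with hT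
  have hhalf : ∀ s : ℂ, 1 / 2 < s.re → Fn s = (1 - 2 * s) / (1 + 2 * s) * (archScalarSection (-1) (-s) h * T) := by
    intro s hs'
    have hF : ∀ g : Matrix (Fin 2 ⊕ Fin 2) (Fin 2 ⊕ Fin 2) ℂ, gᴴ * Matrix.J (Fin 2) ℂ * g = Matrix.J (Fin 2) ℂ →
        F s g = archScalarSection (-1) s g *
          ((denom g (I • (1 : Matrix (Fin 2) (Fin 2) ℂ)))⁻¹ * denom g (-(I • (1 : Matrix (Fin 2) (Fin 2) ℂ))) * b).trace :=
      fun g hg => eq_pPlusCarrier_of_flat (l := Fin 2) (-1) s (1 / 2) b (hP s hs') (hK s hs') hg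
    rw [hagree s hs', archIntertwiningNormalized_apply, archIntertwining_congr_UJ hF hh, ← archIntertwiningNormalized_apply,
      archIntertwiningNormalized_pPlusCarrier_neg_one hs' hh hb]
  have hUo : IsOpen {s : ℂ | 0 < s.re} := isOpen_lt continuous_const Complex.continuous_re
  have hUc : IsPreconnected {s : ℂ | 0 < s.re} := (convex_halfSpace_re_gt (0 : ℝ)).isPreconnected
  have hG : DifferentiableOn ℂ (fun s : ℂ => (1 - 2 * s) / (1 + 2 * s) * (archScalarSection (-1) (-s) h * T)) {s : ℂ | 0 < s.re} := by
    refine DifferentiableOn.mul ?_ (((differentiable_archScalarSection_neg_param (-1) hh).mul (differentiable_const T)).differentiableOn)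
    refine DifferentiableOn.div (by fun_prop) (by fun_prop) fun s hs' => one_add_two_mul_ne_zero hs'
  have h1U : (1 : ℂ) ∈ {s : ℂ | 0 < s.re} := by
    simp only [mem_setOf_eq, Complex.one_re]
    norm_num
  have hev : Fn =ᶠ[𝓝 (1 : ℂ)] fun s => (1 - 2 * s) / (1 + 2 * s) * (archScalarSection (-1) (-s) h * T) := by
    have hO : IsOpen {s : ℂ | 1 / 2 < s.re} := isOpen_lt continuous_const Complex.continuous_re
    have h1 : (1 : ℂ) ∈ {s : ℂ | 1 / 2 < s.re} := by
      simp only [mem_setOf_eq, Complex.one_re]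
      norm_num
    exact Filter.eventuallyEq_of_mem (hO.mem_nhds h1) fun s hs' => hhalf s hs'
  have heq := (hFn.analyticOnNhd hUo).eqOn_of_preconnected_of_eventuallyEq (hG.analyticOnNhd hUo) hUc h1U hev one_half_re_pos
  rw [heq]
  simp only
  rw [show (1 - 2 * (1 / 2 : ℂ)) = 0 by ring, zero_div, zero_mul]

end Summit.HodgeConjecture.HodgeConjecture.Cruxes.HLiu418.K2LiuArchPPlusIntertwiningKernel

end
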